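import Literature.AlgebraicGeometry.Resolution.ResolutionOfSingularities
import Literature.AlgebraicGeometry.Resolution.NormalizationOfVarietiesProofs
import Literature.RingTheory.RegularLocalRing.QuotientDVR
import Literature.AlgebraicGeometry.Dimension.FibreLocalRingDimension
import Mathlib.RingTheory.Localization.Integral
import Mathlib.RingTheory.Localization.Finiteness
import HarnessLib

/-!
# Route `RadicialJung`, crux `CleanModels`, line `Sketch`: stub `stub_curveStalks`

Route `ResolutionOfSingularities/RadicialJung`, crux item `CleanModels`
(stmt-ResolutionOfSingularities-15917), calibration of the crux in dimension `≤ 1`. **Stalks of a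
regular curve**: for a regular integral scheme `W` locally of finite type over a field `k` with
`dim W ≤ 1` and a finite extension `L/K(W)`, every local ring `𝒪_{W,w}` is either a field (at the
generic point) or a discrete valuation ring whose integral closure in `L` is a finite
`𝒪_{W,w}`-module.

Proof. `dim 𝒪_{W,w} = coheight w ≤ dim W ≤ 1` (Mathlib `ringKrullDim_stalk_eq_coheight` and
`height w + coheight w ≤ dim W`). In dimension `0` the Noetherian local domain `𝒪_{W,w}` is a
field; in dimension `1` the regular local ring `𝒪_{W,w}` is a DVR (Matsumura, Thm. 11.2,
`isDiscreteValuationRing_of_ringKrullDim_eq_one`). Finiteness (Liu 2002, Prop. 4.1.27 localised):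
on an affine open `U = Spec A ∋ w`, `A` is a finitely generated `k`-domain with `Frac A = K(W)`,
so `integralClosure A L` is a finite `A`-module (E. Noether, `NoetherFiniteIntegralClosure_holds`);
`𝒪_{W,w} = A_𝔭` and `integralClosure 𝒪_{W,w} L` is the localisation of `integralClosure A L` at
the image of `A ∖ 𝔭` (Mathlib `IsLocalization.integralClosure`), hence finite over `𝒪_{W,w}`
(Mathlib `Module.Finite.of_isLocalization`).

## References

* Q. Liu, *Algebraic Geometry and Arithmetic Curves* (2002), Prop. 4.1.27. [Liu2002]
* H. Matsumura, *Commutative Ring Theory* (1986), Thm. 11.2. [Matsumura1987]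
-/

noncomputable section

set_option linter.dupNamespace false -- mandated namespace of this single-conjunct summit

open CategoryTheory AlgebraicGeometry TopologicalSpace
open Literature.AlgebraicGeometry.Resolution

namespace Summit.ResolutionOfSingularities.ResolutionOfSingularities.Theorems.RadicialJung.CleanModels

/-- **The integral closure of a local ring of a variety in a finite extension of its function field
is a finite module** (E. Noether's finiteness on an affine neighbourhood, localised; Liu 2002,
Prop. 4.1.27). Here `L` is an arbitrary `𝒪_{W,w}`-algebra compatible with `𝒪_{W,w} → K(W) → L`.
[cite: Liu2002, Prop. 4.1.27, p. 122] -/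
theorem finite_integralClosure_stalk {k : Type} [Field k] (W : Scheme.{0}) [IsIntegral W]
    (f : W ⟶ Spec (.of k)) [LocallyOfFiniteType f] (L : Type) [Field L]
    [Algebra W.functionField L] [FiniteDimensional W.functionField L] (w : W)
    [Algebra (W.presheaf.stalk w) L] [IsScalarTower (W.presheaf.stalk w) W.functionField L] :
    Module.Finite (W.presheaf.stalk w) (integralClosure (W.presheaf.stalk w) L) := by
  -- an affine open neighbourhood `U = Spec A` of `w`
  obtain ⟨_, ⟨U, hU, rfl⟩, hwU, -⟩ := W.isBasis_affineOpens.exists_subset_of_mem_open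
    (Set.mem_univ w) isOpen_univ
  haveI : Nonempty U := ⟨⟨w, hwU⟩⟩
  -- `A = Γ(W, U)` is a finitely generated `k`-algebra, a domain with fraction field `K(W)`
  let φ : k →+* Γ(W, U) :=
    (f.appLE ⊤ U le_top).hom.comp (Scheme.ΓSpecIso (.of k)).inv.hom
  have hφ : φ.FiniteType := by
    refine RingHom.FiniteType.comp ?_ (RingHom.FiniteType.of_surjective _
      (Scheme.ΓSpecIso (.of k)).symm.commRingCatIsoToRingEquiv.surjective)
    exact HasRingHomProperty.appLE @LocallyOfFiniteType f ‹_› ⟨⊤, isAffineOpen_top _⟩ ⟨U, hU⟩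
      le_top
  letI : Algebra k Γ(W, U) := φ.toAlgebra
  haveI : Algebra.FiniteType k Γ(W, U) := hφ
  haveI : IsFractionRing Γ(W, U) W.functionField :=
    functionField_isFractionRing_of_isAffineOpen W U hU
  -- `L` as a `Γ(W, U)`-algebra through `K(W)`
  letI algL : Algebra Γ(W, U) L :=
    ((algebraMap W.functionField L).comp (W.germToFunctionField U).hom).toAlgebra
  haveI : IsScalarTower Γ(W, U) W.functionField L :=
    IsScalarTower.of_algebraMap_eq (R := Γ(W, U)) (S := W.functionField) (A := L) fun a => rfl
  -- E. Noether: the integral closure of `A` in `L` is finite over `A`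
  haveI hfin : Module.Finite Γ(W, U) (integralClosure Γ(W, U) L) :=
    NoetherFiniteIntegralClosure_holds k Γ(W, U) W.functionField L
  -- the stalk `𝒪_{W,w}` is the localisation of `A` at the prime `𝔮` of `w`
  obtain ⟨q, hq⟩ : ∃ q : PrimeSpectrum Γ(W, U), q = hU.primeIdealOf ⟨w, hwU⟩ := ⟨_, rfl⟩
  letI algO := TopCat.Presheaf.algebra_section_stalk W.presheaf (⟨w, hwU⟩ : U)
  haveI hO : IsLocalization.AtPrime (W.presheaf.stalk w) q.asIdeal := by
    rw [hq]; exact hU.isLocalization_stalk ⟨w, hwU⟩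
  haveI hT := functionField_isScalarTower W U (⟨w, hwU⟩ : U)
  haveI : IsScalarTower Γ(W, U) (W.presheaf.stalk w) L := by
    refine IsScalarTower.of_algebraMap_eq fun r => ?_
    rw [IsScalarTower.algebraMap_apply (W.presheaf.stalk w) W.functionField L,
      ← IsScalarTower.algebraMap_apply Γ(W, U) (W.presheaf.stalk w) W.functionField]
    rfl
  -- the inclusion `integralClosure A L ⊆ integralClosure 𝒪_{W,w} L`
  let incl : integralClosure Γ(W, U) L →+* integralClosure (W.presheaf.stalk w) L :=
    { toFun := fun x => ⟨(x : L), IsIntegral.tower_top (A := (W.presheaf.stalk w : Type))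
          (show IsIntegral Γ(W, U) (x : L) from x.2)⟩
      map_one' := rfl
      map_mul' := fun _ _ => rfl
      map_zero' := rfl
      map_add' := fun _ _ => rfl }
  letI algCC := incl.toAlgebra
  haveI : IsScalarTower (integralClosure Γ(W, U) L)
      (integralClosure (W.presheaf.stalk w) L) L :=
    IsScalarTower.of_algebraMap_eq fun x => rfl
  haveI : IsScalarTower Γ(W, U) (integralClosure Γ(W, U) L)
      (integralClosure (W.presheaf.stalk w) L) :=
    IsScalarTower.of_algebraMap_eq fun r => Subtype.ext rfl
  -- `L` is its own localisation at the image of `A ∖ 𝔮` (nonzero elements are units)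
  have hinjRL : Function.Injective (algebraMap Γ(W, U) L) :=
    (algebraMap W.functionField L).injective.comp (W.germToFunctionField_injective U)
  haveI : IsLocalization (Algebra.algebraMapSubmonoid L q.asIdeal.primeCompl) L := by
    refine IsLocalization.of_le_isUnit fun x hx => ?_
    obtain ⟨r, hr, rfl⟩ := hx
    refine (Ne.isUnit ?_ : IsUnit (algebraMap Γ(W, U) L r))
    rw [map_ne_zero_iff _ hinjRL]
    rintro rfl
    exact hr (Ideal.zero_mem _)
  -- integral closure commutes with localisation
  haveI hloc := IsLocalization.integralClosure (R := Γ(W, U)) (S := L)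
    (Rf := (W.presheaf.stalk w : Type)) (Sf := L) q.asIdeal.primeCompl
  -- finiteness localises
  exact Module.Finite.of_isLocalization Γ(W, U) (integralClosure Γ(W, U) L)
    q.asIdeal.primeCompl

/-- **Stalks of a regular curve** (calibration stub of the line `Sketch`). For a regular integral
`W` locally of finite type over a field with `dim W ≤ 1` and a finite extension `L/K(W)`, every
stalk `𝒪_{W,w}` is either a field or a discrete valuation ring whose integral closure in `L` (an
`𝒪_{W,w}`-algebra through `K(W)`) is a finite module: `dim 𝒪_{W,w} = coheight w ≤ dim W ≤ 1`; a
zero-dimensional local domain is a field; a one-dimensional regular local ring is a DVR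
(Matsumura, Thm. 11.2); finiteness is E. Noether's theorem on an affine neighbourhood, localised
(`finite_integralClosure_stalk`). [cite: Matsumura1987, Thm. 11.2] -/
theorem stub_curveStalks {k : Type} [Field k] (W : Scheme.{0}) [IsIntegral W]
    (f : W ⟶ Spec (.of k)) [LocallyOfFiniteType f] (hW : Scheme.IsRegular W)
    (hdim : topologicalKrullDim W ≤ 1) (L : Type) [Field L] [Algebra W.functionField L]
    [FiniteDimensional W.functionField L] (w : W) [Algebra (W.presheaf.stalk w) L]
    [IsScalarTower (W.presheaf.stalk w) W.functionField L] :
    IsField (W.presheaf.stalk w) ∨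
      (IsDiscreteValuationRing (W.presheaf.stalk w) ∧
        Module.Finite (W.presheaf.stalk w) (integralClosure (W.presheaf.stalk w) L)) := by
  haveI hreg : IsRegularLocalRing (W.presheaf.stalk w) := hW w
  -- `coheight w ≤ height w + coheight w ≤ dim W ≤ 1`
  have hco : Order.coheight w ≤ 1 := by
    have h := Literature.AlgebraicGeometry.Dimension.height_add_coheight_le_topologicalKrullDim w
    have h' : ((Order.coheight w : ℕ∞) : WithBot ℕ∞) ≤
        ((Order.height w + Order.coheight w : ℕ∞) : WithBot ℕ∞) :=
      WithBot.coe_le_coe.mpr le_add_self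
    have h1 : ((Order.coheight w : ℕ∞) : WithBot ℕ∞) ≤ ((1 : ℕ∞) : WithBot ℕ∞) :=
      h'.trans (h.trans hdim)
    exact WithBot.coe_le_coe.mp h1
  rcases Order.le_one_iff.mp hco with h0 | h1
  · -- dimension `0`: the local domain `𝒪_{W,w}` is a field
    left
    haveI : Ring.KrullDimLE 0 (W.presheaf.stalk w) :=
      krullDimLE_of_coheight_le (n := 0) (by rw [h0]; exact le_rfl)
    exact Ring.KrullDimLE.isField_of_isDomain
  · -- dimension `1`: a regular local ring of dimension one is a DVR
    right
    have hd : ringKrullDim (W.presheaf.stalk w) = 1 := by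
      rw [ringKrullDim_stalk_eq_coheight, h1]; rfl
    refine ⟨?_, finite_integralClosure_stalk W f L w⟩
    exact Literature.RingTheory.RegularLocalRing.isDiscreteValuationRing_of_ringKrullDim_eq_one hd

end Summit.ResolutionOfSingularities.ResolutionOfSingularities.Theorems.RadicialJung.CleanModels

end
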